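import Literature.MathematicalPhysics.QuantumFieldTheory.SU2ElectricPatternBounds
import HarnessLib

/-!
# Tomboulis–Yaffe 1985, Theorems I and II — DISCHARGED

The named facts `PolyakovTwoPointLowerBound` (Theorem I, in its printed corollary form: the Polyakov-loop two-point
function is bounded below uniformly in the volume and the separation, with a deficit `→ 0` as `T → ∞`) and
`MagneticFluxFreeEnergyBound` (Theorem II: `exp(−F^{mag}/T) ≤ 1 − 2e^{−ρ(T)}`) of
`SU2HighTemperatureNonConfinement.lean` are theorems: the tree's Peierls reduction
(`SU2HighTemperaturePeierlsReduction.polyakovTwoPointLowerBound_of_disorderBounds`,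
`magneticFluxFreeEnergyBound_of_disorderBounds`) reduces both to the disorder bounds (3.5)–(3.6); the chessboard /
reflection-positivity step (`FiniteTemperaturePolyakovChessboard.disorderBounds_of_electricPatternBounds`) reduces
those to the two electric pattern bounds at `J_M = 0`; and `SU2ElectricPatternBounds.electricPatternBounds` proves the
pattern bounds (TY §III.C (3.9)–(3.24)) from the transfer-kernel estimates.  The `_holds` theorems live in this
separate file because the facts file is imported (transitively) by the proof files.
[cite: TomboulisYaffe1985, Theorems I–II (p. 320), §III pp. 321–325]

Beyond the printed binders (`L_t = 2^a`, `L_s = 2^k`, "for technical convenience", p. 314): the same chain runs at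
EVERY temporal extent `L₀ ≥ 1` and in every EVEN spatial box `L_s = 2n+2 ≥ 4` — see
`SU2HighTemperatureLongRangeOrder.lean` (`polyakovCorrelation_ge_allExtents`, `magneticFluxExp_le_half_allExtents`),
which also records the barrier's positive notion `FiniteTemperature.HasPolyakovLongRangeOrder d L₀ (fundamentalRep (Fin 2))`
for `SU(2)` in every `d ≥ 2` at every `L₀` (`hasPolyakovLongRangeOrder_su2`; the facts file's §4 explains why the
`2^k` boxes alone do not give it) and the failure of the barrier classes (i)/(ii) at every `L₀`
(`su2_not_polyakovConfinementAtAllCouplings`, `su2_not_uniformClusteringAtAllCouplings`).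
-/

open Filter Topology
open Literature.MathematicalPhysics.QuantumLattice (fundamentalRep)
open Literature.Barriers.QuantumFields Literature.Barriers.QuantumFields.FiniteTemperature

namespace Literature.MathematicalPhysics.QuantumFieldTheory.TomboulisYaffeHighTemperature

/-- **Tomboulis–Yaffe's disorder bounds (3.5)–(3.6)**: for `γ > 0`, `d ≥ 2`, `L₀ = 2^a` there are `θ₀` and a rate
`K(θ) → 0` such that for `θ > θ₀` and every spatial box `L = 2^k ≥ 4`, at couplings `J_E = γθ`, `J_M = γ/θ`,
`⟨1 − |½trΩ_0|⟩ ≤ K(θ)` and `⟨walls across all bonds of B⟩ ≤ K(θ)^{|B|}` for every finite bond set `B`.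
[cite: TomboulisYaffe1985, §III.B (3.5)–(3.6), p. 322] -/
theorem tomboulisYaffe_disorderBounds :
    ∀ γ : ℝ, 0 < γ → ∀ d : ℕ, 2 ≤ d → ∀ a : ℕ,
      ∃ θ₀ : ℝ, ∃ K : ℝ → ℝ, Tendsto K atTop (𝓝 0) ∧
        ∀ θ : ℝ, θ₀ < θ → ∀ k : ℕ, 2 ≤ k →
          expectation (d := d) (L₀ := 2 ^ a) (L := 2 ^ k) (fundamentalRep (Fin 2)) (γ * θ) (γ / θ)
              (fun U => 1 - |halfTrace U 0|) ≤ K θ ∧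
          ∀ B : Finset ((Fin d → ZMod (2 ^ k)) × Fin d),
            expectation (d := d) (L₀ := 2 ^ a) (L := 2 ^ k) (fundamentalRep (Fin 2)) (γ * θ) (γ / θ)
              ((wallEvent B).indicator 1) ≤ K θ ^ B.card :=
  disorderBounds_of_electricPatternBounds electricPatternBounds

/-- **THEOREM I of Tomboulis–Yaffe (1985)** — the named fact `PolyakovTwoPointLowerBound` holds.
[cite: TomboulisYaffe1985, Theorem I (p. 320) and its corollary (p. 321)] -/
theorem PolyakovTwoPointLowerBound_holds : PolyakovTwoPointLowerBound :=
  polyakovTwoPointLowerBound_of_disorderBounds tomboulisYaffe_disorderBounds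

/-- **THEOREM II of Tomboulis–Yaffe (1985)** — the named fact `MagneticFluxFreeEnergyBound` holds.
[cite: TomboulisYaffe1985, Theorem II (p. 320) and its equivalent form (p. 321)] -/
theorem MagneticFluxFreeEnergyBound_holds : MagneticFluxFreeEnergyBound :=
  magneticFluxFreeEnergyBound_of_disorderBounds tomboulisYaffe_disorderBounds

/-! ### (append) The proved corollaries of the facts file, unconditionally

The six corollaries of `SU2HighTemperatureNonConfinement.lean` §§3–4 take the facts as hypotheses
`(h : PolyakovTwoPointLowerBound)` ∕ `(h : MagneticFluxFreeEnergyBound)`; fed with the `_holds` theorems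
above they are closed theorems.  For `SU(2)` lattice gauge theory at every temporal extent `L₀ = 2^a` in
EVERY `d ≥ 2` space dimensions — the tree's Borgs–Seiler refutations
`Literature.Barriers.QuantumFields.not_…_specialUnitary_holds` (`FiniteTemperatureDeconfinementHolds`) need
`d ≥ 3` — the technique classes (i) `PolyakovConfinementAtAllCouplings` ∕
`TemperatureBlindPolyakovConfinement` and (ii) `UniformClusteringAtAllCouplings` ∕
`TemperatureBlindUniformClustering` of the barrier `FiniteTemperatureDeconfinement` fail; at high
temperature a non-decaying thermodynamic limit of the Polyakov correlation exists, and the electric-flux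
free energy stays bounded uniformly in the spatial volume.  Finite-temperature LATTICE statements; one-line
compositions, no new content. -/

/-- **`exp(−F^{elec}_{01}/T) ≥ ε(T) > 0` uniformly in `L_s` at high temperature — `SU(2)`, `d ≥ 2`,
`L₀ = 2^a`, couplings `(γθ, γ/θ)`, unconditionally** (Theorem II with (2.9)).
[cite: TomboulisYaffe1985, §III Theorem II (p. 320); §II.A eq. (2.9) (p. 317)] -/
theorem electricFluxExp_pos_su2_holds {γ : ℝ} (hγ : 0 < γ) {d : ℕ} (hd : 2 ≤ d) (a : ℕ) :
    ∃ θ₀ : ℝ, ∀ θ : ℝ, θ₀ < θ → ∃ ε : ℝ, 0 < ε ∧ ∀ k : ℕ, 2 ≤ k →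
      ε ≤ electricFluxExp (d := d) (L₀ := 2 ^ a) (L := 2 ^ k) (fundamentalRep (Fin 2))
        (γ * θ) (γ / θ) ⟨0, by omega⟩ :=
  MagneticFluxFreeEnergyBound_holds.electricFlux_pos hγ hd a

/-- **No volume-uniform exponential clustering of Polyakov loops at all couplings for `SU(2)` in every
`d ≥ 2` at every temporal extent `L₀ = 2^a`, unconditionally**: class (ii) of the barrier
`FiniteTemperatureDeconfinement` is refuted in `2+1` dimensions as well.
[cite: TomboulisYaffe1985, §III Theorem I (p. 320)] -/
theorem not_uniformClusteringAtAllCouplings_su2_holds {d : ℕ} (hd : 2 ≤ d) (a : ℕ) :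
    ¬ FiniteTemperature.UniformClusteringAtAllCouplings d (2 ^ a) (fundamentalRep (Fin 2)) :=
  PolyakovTwoPointLowerBound_holds.not_uniformClusteringAtAllCouplings one_pos hd a

/-- **… hence the temperature-blind class (ii) fails for `SU(2)` in every `d ≥ 2`, unconditionally.**
[cite: TomboulisYaffe1985, §III Theorem I (p. 320)] -/
theorem not_temperatureBlindUniformClustering_su2_holds {d : ℕ} (hd : 2 ≤ d) :
    ¬ FiniteTemperature.TemperatureBlindUniformClustering d (fundamentalRep (Fin 2)) :=
  PolyakovTwoPointLowerBound_holds.not_temperatureBlindUniformClustering hd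

/-- **A non-decaying thermodynamic limit of the `SU(2)` Polyakov correlation at high temperature,
unconditionally** (`d ≥ 2`, `L₀ = 2^a`, couplings `(γθ, γ/θ)` with `θ > θ₀`): along a subsequence of the
boxes `L = 2^{j+2}` the two-point function converges pointwise on `ℤ^d` to some `G∞ ≥ 4e^{−μ(θ)}`, where
`μ(θ) → 0`. [cite: TomboulisYaffe1985, §III Theorem I (p. 320) and its corollary (p. 321)] -/
theorem exists_isThermodynamicLimit_ge_su2_holds {γ : ℝ} (hγ : 0 < γ) {d : ℕ} (hd : 2 ≤ d) (a : ℕ) :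
    ∃ θ₀ : ℝ, ∃ μ : ℝ → ℝ, Tendsto μ atTop (𝓝 0) ∧ ∀ θ : ℝ, θ₀ < θ →
      ∃ Ginf : (Fin d → ℤ) → ℝ,
        FiniteTemperature.IsThermodynamicLimit (d := d) (L₀ := 2 ^ a) (fundamentalRep (Fin 2))
          (γ * θ) (γ / θ) Ginf ∧ ∀ x, 4 * Real.exp (-μ θ) ≤ Ginf x :=
  PolyakovTwoPointLowerBound_holds.exists_isThermodynamicLimit_ge hγ hd a

/-- **Polyakov's confinement criterion fails at high temperature for `SU(2)` in every `d ≥ 2` at every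
temporal extent `L₀ = 2^a`, unconditionally**: class (i) of the barrier `FiniteTemperatureDeconfinement`
is refuted (the Borgs–Seiler refutation `not_polyakovConfinementAtAllCouplings_specialUnitary_holds` needs
`d ≥ 3`). [cite: TomboulisYaffe1985, §III Theorem I (p. 320); §I result A (p. 313)] -/
theorem not_polyakovConfinementAtAllCouplings_su2_holds {d : ℕ} (hd : 2 ≤ d) (a : ℕ) :
    ¬ FiniteTemperature.PolyakovConfinementAtAllCouplings d (2 ^ a) (fundamentalRep (Fin 2)) :=
  PolyakovTwoPointLowerBound_holds.not_polyakovConfinementAtAllCouplings one_pos hd a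

/-- **… hence the temperature-blind class (i) fails for `SU(2)` in every `d ≥ 2`, unconditionally** —
in `d = 2` a genuinely non-abelian statement (for `U(1)` the class HOLDS there, McBryan–Spencer; tree:
`u1_temperatureBlindPolyakovConfinement_iff`). [cite: TomboulisYaffe1985, §III Theorem I (p. 320); §I result A (p. 313)] -/
theorem not_temperatureBlindPolyakovConfinement_su2_holds {d : ℕ} (hd : 2 ≤ d) :
    ¬ FiniteTemperature.TemperatureBlindPolyakovConfinement d (fundamentalRep (Fin 2)) :=
  PolyakovTwoPointLowerBound_holds.not_temperatureBlindPolyakovConfinement hd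

end Literature.MathematicalPhysics.QuantumFieldTheory.TomboulisYaffeHighTemperature
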